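import Mathlib
import Summits.Langlands.Langlands.Theorems.PhantomRMYoshidaStableYoshidaCongruenceResidualLatticeCharpoly
import Summits.Langlands.Langlands.Theorems.PhantomRMYoshidaStableYoshidaCongruenceResidualLatticeFrame
import Summits.Langlands.Langlands.Theorems.PhantomRMYoshidaStableYoshidaCongruenceResidualLatticeFlag
import Summits.Langlands.Langlands.Theorems.PhantomRMYoshidaStableYoshidaCongruenceDistinguishedTransferLocal
import Literature.NumberTheory.GaloisRepresentations.StableLatticeValuationRing
import Literature.NumberTheory.GaloisRepresentations.ResidualRepresentation
import Literature.NumberTheory.GaloisRepresentations.ResidualGaloisRep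
import Literature.NumberTheory.GaloisRepresentations.AbsolutelyIrreducibleReduction
import Literature.NumberTheory.GaloisRepresentations.ResidualPairProofs
import Literature.NumberTheory.GaloisRepresentations.CrystallineOrdinaryShape
import Literature.NumberTheory.GaloisRepresentations.LocalKroneckerWeberInertiaProofs
import HarnessLib

/-!
# Route `PhantomRMYoshida`, crux `StableYoshidaCongruence` (stmt-Langlands-13640), line
# `burkhardt-weddle-two-three-anchor`: Stub 4 `stub_residualLattice` (the lead's stub)

Registered signature, verbatim.  Let `p` be odd, `red : 𝒪_{ℚ̄_p} → k` (`k` of characteristic `p`, discrete),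
`ρ : Γ_ℚ → GL₄(ℚ̄_p)` Greenberg-ordinary of shape `(0,0,1,1)` and residually distinguished at `v ∣ p`, with
residual pair `(σ, σ')` through `red`.  We construct a continuous `M : Γ_ℚ → GL₄(k)` — the reduction of a
`Γ_ℚ`-stable `𝒪`-lattice written in a basis ADAPTED to the Greenberg flag — with (M1) the characteristic
polynomials of `σ ⊕ σ'` everywhere, (M2) block upper triangular shape `2 + 2` at `v` with triangular top
block, (M3) inertia trivial on the top block, (M4) the two top diagonal characters distinct.

Proof.  Conjugate `ρ` globally by its Greenberg frame `g` (so `ρ' = g ρ g⁻¹` is upper triangular on `Γ_{ℚ_v}`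
with inertia `[[1,0,*,*],[0,1,*,*],[0,0,ε⁻¹,0],[0,0,0,ε⁻¹]]`); take a `Γ_ℚ`-stable `𝒪`-lattice `P·𝒪⁴`
(`exists_integralModel_of_valuationSubring`, `𝒪 = ℤ̄_p` the non-Noetherian valuation ring) and change its
basis inside `GL₄(𝒪)` so that `Q = P·A` maps `e₀` into `ℚ̄_p e₀` and `e₁` into `ℚ̄_p e₀ ⊕ ℚ̄_p e₁`
(`exists_GL_adapted_flag`); then `Q⁻¹ ρ' Q` is integral, and on `Γ_{ℚ_v}` it preserves the standard flag
with the SAME first two diagonal entries as `ρ'` (`conj_flag_shape`, a `4 × 4` identity); reduce modulo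
`𝔪 = ker red` (continuity: `isOpen_ker_residualRep`).  (M1) is the pointwise residual factorisation
`exists_map_red_charpoly_eq_mul_of_hasResidualPair` (Chebotarev); (M4) is the argument of the landed LTWS
Stub 1b (`exists_redDiagChar`, Brauer–Nesbitt for sums of characters, an inertia element with `ε = -1`):
ANY Greenberg frame of a residually distinguished `ρ` has residually distinct weight-`0` characters.
Everything used is proved in the tree.
-/

set_option linter.dupNamespace false

noncomputable section

open Literature.NumberTheory.GaloisRepresentations Literature.NumberTheory.Automorphic
open IsDedekindDomain Matrix Polynomial
open scoped NumberField
open Summit.Langlands.Langlands.Cruxes.StableYoshidaCongruence.LevelThreeWeierstrassSwitch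
  (red_eq_zero_of_norm_lt_one norm_lt_one_of_red_eq_zero exists_redDiagChar card_filter_eq_of_prod_X_sub_C_eq
    ne_and_ne_of_card_filter_eq shape0011_eq_iff primesEquiv_eq_of_natCast_mem algebraMap_inv_neg_one_pow
    red_eq_red_iff)

namespace Summit.Langlands.Langlands.Cruxes.StableYoshidaCongruence.BurkhardtWeddleTwoThreeAnchor

/-! ## The stub -/

/-- **Stub 4 (`stub_residualLattice`) — the registered signature.**  `p` odd; `red : 𝒪_{ℚ̄_p} → k` to a
field of characteristic `p`; `ρ : Γ_ℚ → GL₄(ℚ̄_p)` Greenberg-ordinary of shape `(0,0,1,1)` and residually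
distinguished at `v ∣ p`, with residual pair `(σ, σ')` through `red`.  Then some continuous
`M : Γ_ℚ → GL₄(k)` — the reduction of a `Γ_ℚ`-stable `𝒪`-lattice in a basis adapted to the Greenberg flag —
has (M1) `charpoly M(τ) = charpoly σ(τ) · charpoly σ'(τ)` for all `τ`, (M2) block upper triangular shape at
`v` with triangular top block, (M3) inertia trivial on the top block, (M4) distinct top diagonal characters.
[cite: SerreAbelianLadic1968, Ch. I §1.1 Remark 1, §2.3; DeligneSerreASENS1974, 6.12; Greenberg1991, §2;
BoxerEtAl2021, §7.3] -/
theorem stub_residualLattice :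
    ∀ (p : ℕ) [Fact p.Prime], p ≠ 2 → ∀ (k : Type) [Field k] [CharP k p]
      [TopologicalSpace k] [DiscreteTopology k] (red : Valued.integer (PadicAlgCl p) →+* k)
      (σ σ' : FramedGaloisRep ℚ k 2) (ρ : FramedGaloisRep ℚ (PadicAlgCl p) 4)
      (v : HeightOneSpectrum (𝓞 ℚ)), ((p : ℕ) : 𝓞 ℚ) ∈ v.asIdeal →
      ρ.IsGreenbergOrdinaryOfShapeAt v ![0, 0, 1, 1] → ρ.IsResiduallyDistinguishedAt v ![0, 0, 1, 1] →
      ρ.HasResidualPair red σ σ' →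
      ∃ M : FramedGaloisRep ℚ k 4,
        (∀ τ : Field.absoluteGaloisGroup ℚ,
          FramedRep.charpoly M τ = FramedRep.charpoly σ τ * FramedRep.charpoly σ' τ) ∧
        (∀ τ : Field.absoluteGaloisGroup (v.adicCompletion ℚ),
          (M.toLocal v τ).val 1 0 = 0 ∧ (M.toLocal v τ).val 2 0 = 0 ∧ (M.toLocal v τ).val 3 0 = 0 ∧
          (M.toLocal v τ).val 2 1 = 0 ∧ (M.toLocal v τ).val 3 1 = 0) ∧
        (∀ τ ∈ absInertia (v.adicCompletion ℚ),
          (M.toLocal v τ).val 0 0 = 1 ∧ (M.toLocal v τ).val 1 1 = 1 ∧ (M.toLocal v τ).val 0 1 = 0) ∧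
        (∃ τ : Field.absoluteGaloisGroup (v.adicCompletion ℚ),
          (M.toLocal v τ).val 0 0 ≠ (M.toLocal v τ).val 1 1) := by
  intro p _ hp k _ _ _ _ red σ σ' ρ v hv hGr hdist hpair
  classical
  haveI : CompactSpace (Field.absoluteGaloisGroup ℚ) := absoluteGaloisGroup_compactSpace ℚ
  haveI : CompactSpace (Field.absoluteGaloisGroup (v.adicCompletion ℚ)) :=
    absoluteGaloisGroup_compactSpace _
  -- ### the Greenberg frame `g`, and `ρ' = g ρ g⁻¹`
  rw [FramedGaloisRep.isGreenbergOrdinaryOfShapeAt_iff, FramedRep.isGreenbergOrdinaryOfShape_iff_conj] at hGr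
  obtain ⟨g, htri, hdiag, hblock⟩ := hGr
  set ρ' : FramedGaloisRep ℚ (PadicAlgCl p) 4 := FramedRep.conj g ρ with hρ'
  have hρ'loc : ∀ τ : Field.absoluteGaloisGroup (v.adicCompletion ℚ),
      ρ' (absGaloisRestrict ℚ (v.adicCompletion ℚ) τ) = ((ρ.toLocal v).conj g) τ := fun τ => rfl
  -- ### the integral model over `𝒪 = ℤ̄_p`, in a basis adapted to the flag
  set O : ValuationSubring (PadicAlgCl p) := padicAlgClIntegers p with hO
  have hOopen : IsOpen (O : Set (PadicAlgCl p)) := Valued.isOpen_valuationSubring _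
  obtain ⟨P, ρ₀, hρ₀⟩ := exists_integralModel_of_valuationSubring (O := O) hOopen
    (ρ' : FramedGaloisRep ℚ (PadicAlgCl p) 4)
  obtain ⟨A, hA0, hA1⟩ := exists_GL_adapted_flag O P
  set Q : GL (Fin 4) (PadicAlgCl p) := P * Matrix.GeneralLinearGroup.map O.subtype A with hQ
  have hQ0 : ∀ i : Fin 4, i ≠ 0 → (Q : Matrix (Fin 4) (Fin 4) (PadicAlgCl p)) i 0 = 0 := hA0
  have hQ1 : ∀ i : Fin 4, 2 ≤ (i : ℕ) → (Q : Matrix (Fin 4) (Fin 4) (PadicAlgCl p)) i 1 = 0 := hA1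
  obtain ⟨hQi0, hQi1⟩ := inv_flag_shape Q hQ0 hQ1
  set ρ₁ : Field.absoluteGaloisGroup ℚ →* GL (Fin 4) O := (MulAut.conj A⁻¹).toMonoidHom.comp ρ₀ with hρ₁
  have hρ₁map : ∀ γ, Matrix.GeneralLinearGroup.map O.subtype (ρ₁ γ) = Q⁻¹ * ρ' γ * Q := by
    intro γ
    have h1 : ρ₁ γ = A⁻¹ * ρ₀ γ * A := by simp [hρ₁]
    rw [h1, map_mul, map_mul, map_inv, hρ₀ γ, hQ, _root_.mul_inv_rev]
    simp only [mul_assoc]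
  have hentry : ∀ γ (i j : Fin 4),
      ((((ρ₁ γ : GL (Fin 4) O) : Matrix (Fin 4) (Fin 4) O) i j : O) : PadicAlgCl p) =
        ((Q⁻¹ * ρ' γ * Q : GL (Fin 4) (PadicAlgCl p)) : Matrix (Fin 4) (Fin 4) (PadicAlgCl p)) i j :=
    fun γ i j => (FramedRep.coe_apply_eq_of_map_eq (hρ₁map γ) i j).symm
  -- ### reduction modulo `𝔪 = ker red`
  have hO1 : ∀ x : PadicAlgCl p, x ∈ O ↔ ‖x‖ ≤ 1 := padicAlgCl_mem_valuationSubring_iff p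
  -- `red`, re-typed on `O` (the carriers of `O` and `𝒪[ℚ̄_p]` coincide definitionally)
  let redO : O →+* k := red
  have hredO : ∀ x : O, redO x = red x := fun _ => rfl
  have hredm : ∀ x : O, x ∈ IsLocalRing.maximalIdeal O → redO x = 0 := fun x hx =>
    red_eq_zero_of_norm_lt_one red x ((mem_maximalIdeal_iff_norm_lt_one hO1 x).1 hx)
  set Mm : Field.absoluteGaloisGroup ℚ →* GL (Fin 4) k :=
    (Matrix.GeneralLinearGroup.map redO).comp ρ₁ with hMm
  have hMmval : ∀ γ (i j : Fin 4), ((Mm γ : GL (Fin 4) k) : Matrix (Fin 4) (Fin 4) k) i j =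
      redO (((ρ₁ γ : GL (Fin 4) O) : Matrix (Fin 4) (Fin 4) O) i j) := fun _ _ _ => rfl
  have hmopen : IsOpen {x : PadicAlgCl p | ∃ h : x ∈ O, (⟨x, h⟩ : O) ∈ IsLocalRing.maximalIdeal O} := by
    have hball : {x : PadicAlgCl p | ∃ h : x ∈ O, (⟨x, h⟩ : O) ∈ IsLocalRing.maximalIdeal O} =
        Metric.ball (0 : PadicAlgCl p) 1 := by
      ext x
      simp only [Set.mem_setOf_eq, mem_ball_zero_iff]
      constructor
      · rintro ⟨hx, hm⟩
        exact (mem_maximalIdeal_iff_norm_lt_one hO1 ⟨x, hx⟩).1 hm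
      · intro hx
        exact ⟨(hO1 x).2 hx.le, (mem_maximalIdeal_iff_norm_lt_one hO1 _).2 hx⟩
    rw [hball]
    exact Metric.isOpen_ball
  have hker₀ : IsOpen ((((Matrix.GeneralLinearGroup.map (IsLocalRing.residue O)).comp ρ₁).ker :
      Subgroup (Field.absoluteGaloisGroup ℚ)) : Set (Field.absoluteGaloisGroup ℚ)) :=
    isOpen_ker_residualRep hmopen hρ₁map
  have hle : ((Matrix.GeneralLinearGroup.map (IsLocalRing.residue O)).comp ρ₁).ker ≤ Mm.ker := by
    intro γ hγ
    rw [MonoidHom.mem_ker] at hγ ⊢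
    refine Units.ext (Matrix.ext fun i j => ?_)
    have h := congrArg (fun Xg : GL (Fin 4) (IsLocalRing.ResidueField O) =>
      (Xg : Matrix (Fin 4) (Fin 4) (IsLocalRing.ResidueField O)) i j) hγ
    change IsLocalRing.residue O (((ρ₁ γ : GL (Fin 4) O) : Matrix (Fin 4) (Fin 4) O) i j) =
      (1 : Matrix (Fin 4) (Fin 4) (IsLocalRing.ResidueField O)) i j at h
    rw [hMmval, Units.val_one]
    by_cases hij : i = j
    · subst hij
      rw [Matrix.one_apply_eq] at h ⊢
      have h' : IsLocalRing.residue O (((ρ₁ γ : GL (Fin 4) O) : Matrix (Fin 4) (Fin 4) O) i i - 1) = 0 := by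
        rw [map_sub, map_one, h, sub_self]
      have h'' := hredm _ ((IsLocalRing.residue_eq_zero_iff _).1 h')
      rwa [map_sub, map_one, sub_eq_zero] at h''
    · rw [Matrix.one_apply_ne hij] at h ⊢
      exact hredm _ ((IsLocalRing.residue_eq_zero_iff _).1 h)
  have hcont : Continuous Mm := continuous_of_isOpen_ker Mm (Subgroup.isOpen_mono hle hker₀)
  let M : FramedGaloisRep ℚ k 4 := ⟨Mm, hcont⟩
  have hMloc : ∀ (τ : Field.absoluteGaloisGroup (v.adicCompletion ℚ)) (i j : Fin 4),
      (M.toLocal v τ).val i j =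
        redO (((ρ₁ (absGaloisRestrict ℚ (v.adicCompletion ℚ) τ) : GL (Fin 4) O) :
          Matrix (Fin 4) (Fin 4) O) i j) := fun _ _ _ => rfl
  -- ### the shape of `Q⁻¹ ρ'(τ) Q` on `Γ_{ℚ_v}`
  have hshape : ∀ τ : Field.absoluteGaloisGroup (v.adicCompletion ℚ),
      let R := ((((ρ.toLocal v).conj g) τ : GL (Fin 4) (PadicAlgCl p)) :
        Matrix (Fin 4) (Fin 4) (PadicAlgCl p))
      let X := fun i j : Fin 4 => ((((ρ₁ (absGaloisRestrict ℚ (v.adicCompletion ℚ) τ) : GL (Fin 4) O) :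
        Matrix (Fin 4) (Fin 4) O) i j : O) : PadicAlgCl p)
      (∀ i : Fin 4, i ≠ 0 → X i 0 = 0) ∧ (∀ i : Fin 4, 2 ≤ (i : ℕ) → X i 1 = 0) ∧
        X 0 0 = R 0 0 ∧ X 1 1 = R 1 1 ∧ (R 0 1 = 0 → R 0 0 = R 1 1 → X 0 1 = 0) := by
    intro τ R X
    have hX : ∀ i j, X i j = (((Q⁻¹ : GL (Fin 4) (PadicAlgCl p)) : Matrix (Fin 4) (Fin 4) (PadicAlgCl p)) *
        R * (Q : Matrix (Fin 4) (Fin 4) (PadicAlgCl p))) i j := by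
      intro i j
      simp only [X, R, hentry, Units.val_mul, hρ'loc]
    have hYZ : (((Q⁻¹ : GL (Fin 4) (PadicAlgCl p)) : Matrix (Fin 4) (Fin 4) (PadicAlgCl p)) *
        (Q : Matrix (Fin 4) (Fin 4) (PadicAlgCl p))) = 1 := by
      rw [← Units.val_mul, inv_mul_cancel, Units.val_one]
    obtain ⟨h0, h1, h00, h11, h01⟩ := conj_flag_shape _ R _ hYZ hQi0 hQi1 hQ0 hQ1 (htri τ)
    exact ⟨fun i hi => (hX i 0).trans (h0 i hi), fun i hi => (hX i 1).trans (h1 i hi),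
      (hX 0 0).trans h00, (hX 1 1).trans h11, fun ha hb => (hX 0 1).trans (h01 ha hb)⟩
  refine ⟨M, fun τ => ?_, fun τ => ?_, fun τ hτ => ?_, ?_⟩
  · -- ### (M1): pointwise residual factorisation
    obtain ⟨Pτ, hPτ, hPτred⟩ := exists_map_red_charpoly_eq_mul_of_hasResidualPair red hpair τ
    have h1 : FramedRep.charpoly M τ =
        (((ρ₁ τ : GL (Fin 4) O) : Matrix (Fin 4) (Fin 4) O).charpoly).map redO := by
      rw [FramedRep.charpoly, ← Matrix.charpoly_map]
      rfl
    have h2 : (((ρ₁ τ : GL (Fin 4) O) : Matrix (Fin 4) (Fin 4) O).charpoly).map O.subtype =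
        FramedRep.charpoly ρ τ := by
      rw [charpoly_integralModel hρ₁map τ]
      exact charpoly_conj_eq g ρ τ
    rw [h1, ← hPτred]
    ext i
    rw [Polynomial.coeff_map, Polynomial.coeff_map, hredO]
    have hc : (((((ρ₁ τ : GL (Fin 4) O) : Matrix (Fin 4) (Fin 4) O).charpoly).coeff i : O) :
        PadicAlgCl p) = ((Pτ.coeff i : Valued.integer (PadicAlgCl p)) : PadicAlgCl p) := by
      have h := congrArg (fun P : Polynomial (PadicAlgCl p) => P.coeff i) (h2.trans hPτ.symm)
      simp only [Polynomial.coeff_map] at h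
      exact h
    exact congrArg red (Subtype.ext hc)
  · -- ### (M2): the flag is preserved
    obtain ⟨h0, h1, -, -, -⟩ := hshape τ
    have hz : ∀ i j : Fin 4, ((((ρ₁ (absGaloisRestrict ℚ (v.adicCompletion ℚ) τ) : GL (Fin 4) O) :
        Matrix (Fin 4) (Fin 4) O) i j : O) : PadicAlgCl p) = 0 → (M.toLocal v τ).val i j = 0 := by
      intro i j h
      rw [hMloc, show (((ρ₁ (absGaloisRestrict ℚ (v.adicCompletion ℚ) τ) : GL (Fin 4) O) :
        Matrix (Fin 4) (Fin 4) O) i j : O) = 0 from Subtype.ext h, map_zero]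
    exact ⟨hz 1 0 (h0 1 (by decide)), hz 2 0 (h0 2 (by decide)), hz 3 0 (h0 3 (by decide)),
      hz 2 1 (h1 2 (by decide)), hz 3 1 (h1 3 (by decide))⟩
  · -- ### (M3): inertia is trivial on the top block
    obtain ⟨-, -, h00, h11, h01⟩ := hshape τ
    have hR00 : ((((ρ.toLocal v).conj g) τ : GL (Fin 4) (PadicAlgCl p)) :
        Matrix (Fin 4) (Fin 4) (PadicAlgCl p)) 0 0 = 1 := by
      have h := hdiag τ hτ 0
      rw [FramedRep.diagEntry_apply] at h
      rw [h]
      simp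
    have hR11 : ((((ρ.toLocal v).conj g) τ : GL (Fin 4) (PadicAlgCl p)) :
        Matrix (Fin 4) (Fin 4) (PadicAlgCl p)) 1 1 = 1 := by
      have h := hdiag τ hτ 1
      rw [FramedRep.diagEntry_apply] at h
      rw [h]
      simp
    have hR01 : ((((ρ.toLocal v).conj g) τ : GL (Fin 4) (PadicAlgCl p)) :
        Matrix (Fin 4) (Fin 4) (PadicAlgCl p)) 0 1 = 0 := hblock τ hτ 0 1 (by decide) rfl
    have hone : ∀ i : Fin 4, ((((ρ₁ (absGaloisRestrict ℚ (v.adicCompletion ℚ) τ) : GL (Fin 4) O) :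
        Matrix (Fin 4) (Fin 4) O) i i : O) : PadicAlgCl p) = 1 → (M.toLocal v τ).val i i = 1 := by
      intro i h
      rw [hMloc, show (((ρ₁ (absGaloisRestrict ℚ (v.adicCompletion ℚ) τ) : GL (Fin 4) O) :
        Matrix (Fin 4) (Fin 4) O) i i : O) = 1 from Subtype.ext h, map_one]
    refine ⟨hone 0 (h00.trans hR00), hone 1 (h11.trans hR11), ?_⟩
    rw [hMloc, show (((ρ₁ (absGaloisRestrict ℚ (v.adicCompletion ℚ) τ) : GL (Fin 4) O) :
      Matrix (Fin 4) (Fin 4) O) 0 1 : O) = 0 from Subtype.ext (h01 hR01 (hR00.trans hR11.symm)), map_zero]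
  · -- ### (M4): any Greenberg frame of a residually distinguished `ρ` is distinguished (LTWS Stub 1b)
    rw [FramedGaloisRep.IsResiduallyDistinguishedAt, FramedRep.isResiduallyDistinguishedOfShape_iff_conj]
      at hdist
    obtain ⟨gd, htrid, hdiagd, hsep⟩ := hdist
    obtain ⟨a, ha, hane, hapr⟩ := exists_redDiagChar red htrid
    obtain ⟨b, hb, hbne, hbpr⟩ := exists_redDiagChar red htri
    -- equal residual characteristic polynomials of the two frames
    have hprod : ∀ τ, ∏ i, (X - C ((a i τ : kˣ) : k)) = ∏ i, (X - C ((b i τ : kˣ) : k)) := fun τ => by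
      obtain ⟨P₀, hP₀⟩ := FramedRep.exists_charpoly_eq_map (ρ.toLocal v) τ
      rw [← hapr τ P₀ (by rw [hP₀, charpoly_conj_eq]), ← hbpr τ P₀ (by rw [hP₀, charpoly_conj_eq])]
    have hcard := card_filter_eq_of_prod_X_sub_C_eq a b hprod
    obtain ⟨σ₀, hσ₀I, hσ₀⟩ := adicCompletion_rat_exists_mem_absInertia_cyclotomicCharacter_eq p v
      (primesEquiv_eq_of_natCast_mem p v hv) (-1)
    have hval : ∀ {r : FramedRep (Field.absoluteGaloisGroup (v.adicCompletion ℚ)) (PadicAlgCl p) 4}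
        {c : Fin 4 → Field.absoluteGaloisGroup (v.adicCompletion ℚ) →* kˣ},
        (∀ (i : Fin 4) τ (x : Valued.integer (PadicAlgCl p)),
          (x : PadicAlgCl p) = r.diagEntry i τ → ((c i τ : kˣ) : k) = red x) →
        (∀ τ ∈ absInertia (v.adicCompletion ℚ), ∀ i : Fin 4, r.diagEntry i τ =
          algebraMap ℚ_[p] (PadicAlgCl p)
            ((((GaloisRep.cyclotomicCharacter (v.adicCompletion ℚ) p τ)⁻¹ : ℤ_[p]ˣ) : ℤ_[p]) :
              ℚ_[p]) ^ (![0, 0, 1, 1] : Fin 4 → ℕ) i) →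
        ∀ i, ((c i σ₀ : kˣ) : k) = (-1) ^ (![0, 0, 1, 1] : Fin 4 → ℕ) i := by
      intro r c hc hd i
      rw [hc i σ₀ ((-1) ^ (![0, 0, 1, 1] : Fin 4 → ℕ) i)
        (by push_cast; rw [hd σ₀ hσ₀I i, hσ₀, algebraMap_inv_neg_one_pow]), map_pow, map_neg, map_one]
    have hu : (-1 : k) ≠ 1 := Ring.neg_one_ne_one_of_char_ne_two (by rw [ringChar.eq k p]; exact hp)
    have hne : ∀ i j : Fin 4, (∃ τ, ‖((ρ.toLocal v).conj gd).diagEntry i τ -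
        ((ρ.toLocal v).conj gd).diagEntry j τ‖ = 1) → a i ≠ a j := by
      rintro i j ⟨τ, hτ⟩ hij
      exact (hane i j τ).2 hτ (DFunLike.congr_fun hij τ)
    obtain ⟨hb01, -⟩ := ne_and_ne_of_card_filter_eq a b hcard hu (hval ha hdiagd)
      (hval hb hdiag) (hne 0 1 (hsep 0 1 (by decide) (by decide)))
      (hne 2 3 (hsep 2 3 (by decide) (by decide)))
    -- a `τ` where the two weight-`0` characters of the frame `g` differ residually
    obtain ⟨τ, hτ⟩ : ∃ τ, b 0 τ ≠ b 1 τ := by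
      by_contra hcon
      push Not at hcon
      exact hb01 (MonoidHom.ext hcon)
    have hnorm : ‖((ρ.toLocal v).conj g).diagEntry 0 τ - ((ρ.toLocal v).conj g).diagEntry 1 τ‖ = 1 :=
      (hbne 0 1 τ).1 hτ
    refine ⟨τ, fun heq => ?_⟩
    obtain ⟨-, -, h00, h11, -⟩ := hshape τ
    dsimp only at h00 h11
    rw [hMloc, hMloc, hredO, hredO, red_eq_red_iff red, h00, h11] at heq
    rw [FramedRep.diagEntry_apply, FramedRep.diagEntry_apply] at hnorm
    rw [hnorm] at heq
    exact lt_irrefl _ heq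

end Summit.Langlands.Langlands.Cruxes.StableYoshidaCongruence.BurkhardtWeddleTwoThreeAnchor

end
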